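import Summits.BirchSwinnertonDyer.BirchSwinnertonDyer.Theorems.EisensteinPrimesMazurMCOnCellBOfNamedFactsV9
import Summits.BirchSwinnertonDyer.BirchSwinnertonDyer.Theorems.EisensteinPrimesMazurMCOnCellBTwistbackDefectSwapUp
import Summits.BirchSwinnertonDyer.BirchSwinnertonDyer.Theorems.EisensteinPrimesMazurMCOnCellBPrimeSupport
import HarnessLib

/-!
# Crux 3 `MazurMCOnCellB` (stmt-BirchSwinnertonDyer-19033) — the crux REDUCES, modulo the PUBLISHED-ONLY cone, to the X2b classes
# WITHOUT a Ш_an-`p`-unit member, at the four primes `p = 3, 5, 7, 13` (the census dichotomy as a kernel theorem, all conductors)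

Width seat bsd-line-x2-p1-w8 (gen 7), cell `bsd-eis`, 2026-08-29; `--supports stmt-BirchSwinnertonDyer-19033 --as helper`. THEOREMS ONLY
(no `def`, no named fact, no `sorry`, no instance). Registered line `twistback` v12 (HELD) untouched.

WHAT. The (Z) CLASS ATLASES (x2-p1-w5/w8 at `p = 5, 7`; this seat at `p = 3`, `…TwistbackShaUnitClassP3Atlas*`) display Mazur's main
conjecture class by class at the X2b classes having a member whose `#Ш_an` is a `p`-adic unit, through LEAD g14's PUB-only door
`…OfNamedFactsV9.mazurMainConjectureAt_of_namedFacts_of_classShaUnit` (cone = {`EisensteinPrimes.PublishedInputs`, Wuthrich 2014 Prop. 21}).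
The census of this seat (`CENSUS-P3-X2B-w8g7.md`, evidence on -19033): at `p = 3`, `N ≤ 5·10⁵`, 8 618 of the 8 745 X2b classes are of this
kind and the remaining 127 are EXACTLY ladder row A10. This file states the corresponding CLASS-WIDE reduction (no reading, no table, every
conductor), so that the bookkeeping sentence «the crux lives on the classes without a Ш-unit member» is a kernel implication:

* §1 `mazurMainConjectureAt_of_cellB_of_not_noShaUnitMember` — per pair: if the class of `W` is NOT Ш-unit-free at `p`, MC at `(W, p)`
  (the V9 door, contrapositive packaging); `bsdp_of_cellB_of_not_noShaUnitMember` likewise for `BSD(E,p)` (w3 g14's door).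
* §2 **`mazurMCOnCellB_of_noShaUnitClasses`**: `MazurMCOnCellB` follows, granted the PUB-only cone, from Mazur's main conjecture on the
  X2b pairs `(W, p)` whose isogeny class has NO globally minimal member `W'` with `#Ш_an(W')` a `p`-adic unit;
  `mazurMCOnCellB_iff_noShaUnitClasses` (the converse is the unconditional projection).
* §3 **`mazurMCOnCellB_of_noShaUnitClasses_of_le_thirteen`**: the same with the prime support of `…PrimeSupport` (Mazur 1978 Thm. 1 +
  the prime-degree `j`-table): it suffices to treat the Ш-unit-free X2b classes at `p ≤ 13` (i.e. `p ∈ {3, 5, 7, 13}`); and the A10 form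
  `mazurMCOnCellB_of_noShaUnitClasses_three_of_five_le` (the `p = 3` Ш-unit-free classes = row A10 in Cremona's range, plus one
  hypothesis on `5 ≤ p ≤ 13`, where the tabulated populations have NO Ш-unit-free class at all: 364/364 at `p = 5`, 33/33 at `p = 7`,
  none tabulated at `p = 13` — readings of record of x2-p1-w5 g5/g6, w8 g6, lam-a g18).

HONEST FRAMING: CONDITIONAL on `PublishedInputs` (item -19037; PUBLISHED results typed as named facts), Wuthrich Prop. 21 (`sha_dvd_analyticSha`,
PUBLISHED) and, in §3, on `mazur_isogeny_irreducible` + `primeDegreeIsogeny_jTable` (PUBLISHED). The remaining hypothesis (MC on the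
Ш-unit-free X2b classes) is the OPEN content of the crux — these files do not shrink it, they LOCATE it; no registered stub is closed; no
summit statement, no case of Mazur's main conjecture and no case of BSD is proved; 0 cells / labels / tiers move.

References: [Wuthrich2014] Thm. 16, Prop. 21; [MilneADT2006] I Thm. 7.3; [Mazur1978] Thm. 1, table p. 129; [CremonaAlgorithms1997] §3.8;
HOME `run/shared/lean/pub/bsd-eis/` (LEAD g16 verdict; this seat's CENSUS-P3-X2B-w8g7.md).
-/

set_option autoImplicit false
-- `Summit.BirchSwinnertonDyer.BirchSwinnertonDyer.…`: the summit and its single sub-problem share a name.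
set_option linter.dupNamespace false

noncomputable section

open scoped Classical
open WeierstrassCurve Literature.NumberTheory.EllipticCurves Literature.NumberTheory.EllipticCurves.Rank1Residual
  Literature.NumberTheory.EllipticCurves.Rank1Residual.Typed
  Literature.NumberTheory.EllipticCurves.Wuthrich2014
  Summit.BirchSwinnertonDyer.Rank1Residual
  Summit.BirchSwinnertonDyer.BirchSwinnertonDyer.Theses
  Summit.BirchSwinnertonDyer.BirchSwinnertonDyer.Theorems

namespace Summit.BirchSwinnertonDyer.BirchSwinnertonDyer.Theorems.EisensteinPrimesMazurMCOnCellBNonUnitClassReduction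

/-! ## §1. Per pair: a class that is not Ш-unit-free is closed by the PUB-only door -/

/-- **MC at an X2b pair whose class is NOT Ш-unit-free** (granted the PUB-only cone): if it is false that every globally minimal
`W' ~ W` has `#Ш_an(W')` a non-unit at `p` — i.e. some isogenous `W'` has `v_p(#Ш_an(W')) = 0` — then Mazur's main conjecture holds at
`(W, p)`, by LEAD g14's `…OfNamedFactsV9.mazurMainConjectureAt_of_namedFacts_of_classShaUnit`. [cite: Wuthrich2014, Thm. 16 (p. 397) and Prop. 21 (p. 400)]
[cite: MilneADT2006, Thm. I.7.3 and Rem. I.7.4] -/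
theorem mazurMainConjectureAt_of_cellB_of_not_noShaUnitMember (hP : EisensteinPrimes.PublishedInputs) (hW21 : sha_dvd_analyticSha)
    (W : WeierstrassCurve ℚ) [W.IsElliptic] [W.IsGloballyMinimal] (p : ℕ) [Fact p.Prime] (hc : X2.CellB W p)
    (h : ¬ ∀ (W' : WeierstrassCurve ℚ) [W'.IsElliptic] [W'.IsGloballyMinimal], IsIsogenous W W' →
      ∀ q : ℚ, shaAn W' = (q : ℂ) → padicValRat p q ≠ 0) :
    X2.MazurMainConjectureAt W p := by
  apply EisensteinPrimesMazurMCOnCellBOfNamedFactsV9.mazurMainConjectureAt_of_namedFacts_of_classShaUnit hP hW21 W p hc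
  by_contra h0
  apply h
  intro W' _ _ hiso q hq hv
  exact h0 ⟨W', inferInstance, inferInstance, hiso, q, hq, hv⟩

/-- **`BSD(E,p)` at an X2b pair whose class is NOT Ш-unit-free** (granted the PUB-only cone), by w3 g14's
`…DefectSwapUp.bsdp_of_cellB_of_classShaUnit`. [cite: Wuthrich2014, Prop. 21 (p. 400)] [cite: MilneADT2006, Thm. I.7.3] [cite: Miller2011LMS, Def. 1.1] -/
theorem bsdp_of_cellB_of_not_noShaUnitMember (hP : EisensteinPrimes.PublishedInputs) (hW21 : sha_dvd_analyticSha)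
    (W : WeierstrassCurve ℚ) [W.IsElliptic] [W.IsGloballyMinimal] (p : ℕ) [Fact p.Prime] (hc : X2.CellB W p)
    (h : ¬ ∀ (W' : WeierstrassCurve ℚ) [W'.IsElliptic] [W'.IsGloballyMinimal], IsIsogenous W W' →
      ∀ q : ℚ, shaAn W' = (q : ℂ) → padicValRat p q ≠ 0) :
    BSDp W p := by
  apply EisensteinPrimesMazurMCOnCellBTwistbackDefectSwapUp.bsdp_of_cellB_of_classShaUnit hP hW21 W p hc
  by_contra h0
  apply h
  intro W' _ _ hiso q hq hv
  exact h0 ⟨W', inferInstance, inferInstance, hiso, q, hq, hv⟩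

/-! ## §2. Class-wide: the crux reduces to the Ш-unit-free X2b classes -/

/-- **`MazurMCOnCellB` from Mazur's main conjecture on the Ш-unit-FREE X2b classes alone** (granted the PUB-only cone
{`PublishedInputs`, Wuthrich Prop. 21}): the hypothesis `h` is asked only at X2b pairs `(W, p)` such that EVERY globally minimal
`W' ~ W` has `v_p(#Ш_an(W')) ≠ 0` (for rational `#Ш_an`); every other X2b pair is closed by §1. At `p = 3` in Cremona's range
(`N ≤ 5·10⁵`) the Ш-unit-free X2b classes are exactly the 127 cells of ladder row A10 (census of this seat); the statement itself
is over all conductors and all primes. [cite: Wuthrich2014, Thm. 16 (p. 397) and Prop. 21 (p. 400)] [cite: MilneADT2006, Thm. I.7.3 and Rem. I.7.4] -/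
theorem mazurMCOnCellB_of_noShaUnitClasses (hP : EisensteinPrimes.PublishedInputs) (hW21 : sha_dvd_analyticSha)
    (h : ∀ (W : WeierstrassCurve ℚ) [W.IsElliptic] [W.IsGloballyMinimal] (p : ℕ) [Fact p.Prime], X2.CellB W p →
      (∀ (W' : WeierstrassCurve ℚ) [W'.IsElliptic] [W'.IsGloballyMinimal], IsIsogenous W W' →
        ∀ q : ℚ, shaAn W' = (q : ℂ) → padicValRat p q ≠ 0) →
      X2.MazurMainConjectureAt W p) :
    EisensteinPrimes.MazurMCOnCellB := by
  intro W _ _ p _ hc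
  by_cases hfree : ∀ (W' : WeierstrassCurve ℚ) [W'.IsElliptic] [W'.IsGloballyMinimal], IsIsogenous W W' →
      ∀ q : ℚ, shaAn W' = (q : ℂ) → padicValRat p q ≠ 0
  · exact h W p hc hfree
  · exact mazurMainConjectureAt_of_cellB_of_not_noShaUnitMember hP hW21 W p hc hfree

/-- **`MazurMCOnCellB` ⟺ Mazur's main conjecture on the Ш-unit-free X2b classes** (granted the PUB-only cone; `⟹` is the
unconditional restriction). [cite: Wuthrich2014, Thm. 16 (p. 397) and Prop. 21 (p. 400)] [cite: MilneADT2006, Thm. I.7.3] -/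
theorem mazurMCOnCellB_iff_noShaUnitClasses (hP : EisensteinPrimes.PublishedInputs) (hW21 : sha_dvd_analyticSha) :
    EisensteinPrimes.MazurMCOnCellB ↔
      ∀ (W : WeierstrassCurve ℚ) [W.IsElliptic] [W.IsGloballyMinimal] (p : ℕ) [Fact p.Prime], X2.CellB W p →
        (∀ (W' : WeierstrassCurve ℚ) [W'.IsElliptic] [W'.IsGloballyMinimal], IsIsogenous W W' →
          ∀ q : ℚ, shaAn W' = (q : ℂ) → padicValRat p q ≠ 0) →
        X2.MazurMainConjectureAt W p :=
  ⟨fun hMC W _ _ p _ hc _ => hMC W p hc, mazurMCOnCellB_of_noShaUnitClasses hP hW21⟩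

/-- The same reduction for `X2.TargetB` (`BSD(E,p)` on cell X2b): it suffices to prove `BSD(E,p)` at the Ш-unit-free X2b classes
(granted the PUB-only cone). [cite: Wuthrich2014, Prop. 21 (p. 400)] [cite: MilneADT2006, Thm. I.7.3] [cite: Miller2011LMS, Def. 1.1] -/
theorem targetB_of_noShaUnitClasses (hP : EisensteinPrimes.PublishedInputs) (hW21 : sha_dvd_analyticSha)
    (h : ∀ (W : WeierstrassCurve ℚ) [W.IsElliptic] [W.IsGloballyMinimal] (p : ℕ) [Fact p.Prime], X2.CellB W p →
      (∀ (W' : WeierstrassCurve ℚ) [W'.IsElliptic] [W'.IsGloballyMinimal], IsIsogenous W W' →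
        ∀ q : ℚ, shaAn W' = (q : ℂ) → padicValRat p q ≠ 0) →
      BSDp W p) :
    X2.TargetB := by
  intro W _ _ p _ hc
  by_cases hfree : ∀ (W' : WeierstrassCurve ℚ) [W'.IsElliptic] [W'.IsGloballyMinimal], IsIsogenous W W' →
      ∀ q : ℚ, shaAn W' = (q : ℂ) → padicValRat p q ≠ 0
  · exact h W p hc hfree
  · exact bsdp_of_cellB_of_not_noShaUnitMember hP hW21 W p hc hfree

/-! ## §3. With the prime support: Ш-unit-free X2b classes at `p ∈ {3, 5, 7, 13}` suffice -/

/-- **`MazurMCOnCellB` from Mazur's main conjecture on the Ш-unit-free X2b classes at `p ≤ 13`** (granted the PUB-only cone and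
Mazur 1978 Thm. 1 + the prime-degree `j`-table, by `…PrimeSupport.mazurMCOnCellB_iff_le_thirteen`): cell X2b is empty at `p ≥ 17`
(and at `2, 11`), and non-free classes are closed by §1. [cite: Mazur1978, Thm. 1 and table p. 129] [cite: CremonaAlgorithms1997, §3.8 p. 82]
[cite: Wuthrich2014, Thm. 16 (p. 397) and Prop. 21 (p. 400)] -/
theorem mazurMCOnCellB_of_noShaUnitClasses_of_le_thirteen (hMaz : mazur_isogeny_irreducible) (hT : primeDegreeIsogeny_jTable)
    (hP : EisensteinPrimes.PublishedInputs) (hW21 : sha_dvd_analyticSha)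
    (h : ∀ (W : WeierstrassCurve ℚ) [W.IsElliptic] [W.IsGloballyMinimal] (p : ℕ) [Fact p.Prime], p ≤ 13 → X2.CellB W p →
      (∀ (W' : WeierstrassCurve ℚ) [W'.IsElliptic] [W'.IsGloballyMinimal], IsIsogenous W W' →
        ∀ q : ℚ, shaAn W' = (q : ℂ) → padicValRat p q ≠ 0) →
      X2.MazurMainConjectureAt W p) :
    EisensteinPrimes.MazurMCOnCellB := by
  rw [EisensteinPrimesMazurMCOnCellBPrimeSupport.mazurMCOnCellB_iff_le_thirteen hMaz hT]
  intro W _ _ p _ hp hc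
  by_cases hfree : ∀ (W' : WeierstrassCurve ℚ) [W'.IsElliptic] [W'.IsGloballyMinimal], IsIsogenous W W' →
      ∀ q : ℚ, shaAn W' = (q : ℂ) → padicValRat p q ≠ 0
  · exact h W p hp hc hfree
  · exact mazurMainConjectureAt_of_cellB_of_not_noShaUnitMember hP hW21 W p hc hfree

/-- **The row-A10 form**: `MazurMCOnCellB` from (i) Mazur's main conjecture on the Ш-unit-free X2b classes at `p = 3` (in Cremona's
range these are exactly the 127 cells of ladder row A10) and (ii) Mazur's main conjecture on the Ш-unit-free X2b classes at
`5 ≤ p ≤ 13` (none tabulated: 364/364 classes at `p = 5` and 33/33 at `p = 7` have a Ш-unit member, `p = 13` has no pair with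
`N ≤ 5·10⁵`), granted the PUB-only cone + Mazur 1978 + the `j`-table. [cite: Mazur1978, Thm. 1 and table p. 129]
[cite: CremonaAlgorithms1997, §3.8 p. 82] [cite: Wuthrich2014, Thm. 16 (p. 397) and Prop. 21 (p. 400)] -/
theorem mazurMCOnCellB_of_noShaUnitClasses_three_of_five_le (hMaz : mazur_isogeny_irreducible)
    (hT : primeDegreeIsogeny_jTable) (hP : EisensteinPrimes.PublishedInputs) (hW21 : sha_dvd_analyticSha)
    (h3 : ∀ (W : WeierstrassCurve ℚ) [W.IsElliptic] [W.IsGloballyMinimal] [Fact (Nat.Prime 3)], X2.CellB W 3 →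
      (∀ (W' : WeierstrassCurve ℚ) [W'.IsElliptic] [W'.IsGloballyMinimal], IsIsogenous W W' →
        ∀ q : ℚ, shaAn W' = (q : ℂ) → padicValRat 3 q ≠ 0) →
      X2.MazurMainConjectureAt W 3)
    (h5 : ∀ (W : WeierstrassCurve ℚ) [W.IsElliptic] [W.IsGloballyMinimal] (p : ℕ) [Fact p.Prime], 5 ≤ p → p ≤ 13 →
      X2.CellB W p →
      (∀ (W' : WeierstrassCurve ℚ) [W'.IsElliptic] [W'.IsGloballyMinimal], IsIsogenous W W' →
        ∀ q : ℚ, shaAn W' = (q : ℂ) → padicValRat p q ≠ 0) →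
      X2.MazurMainConjectureAt W p) :
    EisensteinPrimes.MazurMCOnCellB := by
  refine EisensteinPrimesMazurMCOnCellBPrimeSupport.mazurMCOnCellB_of_three_of_five_le hMaz hT ?_ ?_
  · intro W _ _ _ hc
    by_cases hfree : ∀ (W' : WeierstrassCurve ℚ) [W'.IsElliptic] [W'.IsGloballyMinimal], IsIsogenous W W' →
        ∀ q : ℚ, shaAn W' = (q : ℂ) → padicValRat 3 q ≠ 0
    · exact h3 W hc hfree
    · exact mazurMainConjectureAt_of_cellB_of_not_noShaUnitMember hP hW21 W 3 hc hfree
  · intro W _ _ p _ hp5 hp13 hc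
    by_cases hfree : ∀ (W' : WeierstrassCurve ℚ) [W'.IsElliptic] [W'.IsGloballyMinimal], IsIsogenous W W' →
        ∀ q : ℚ, shaAn W' = (q : ℂ) → padicValRat p q ≠ 0
    · exact h5 W p hp5 hp13 hc hfree
    · exact mazurMainConjectureAt_of_cellB_of_not_noShaUnitMember hP hW21 W p hc hfree

end Summit.BirchSwinnertonDyer.BirchSwinnertonDyer.Theorems.EisensteinPrimesMazurMCOnCellBNonUnitClassReduction

end
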